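import Mathlib
import Literature.Combinatorics.Optimization.UniqueGamesFromTwoLin
import Literature.Combinatorics.Optimization.RandomPairMultigraphCuts
import HarnessLib

/-!
# Random Unique Games are sound (Charikar–Makarychev–Makarychev Thm 6.1 (i), "the standard
# probabilistic argument") — PROVED, and the Unique Games gap reduced to the signed MAX 2LIN(2) gap

[topic Combinatorics/Optimization]

Source: [CharikarMakarychevMakarychev2009] (STOC 2009), proof sketch of Theorem 6.1 (p. 13): "For every
edge `(u, v)` of the graph we pick independently (and uniformly) a random element `π_{uv}` in `{−1,1}^t`.
The constraint between `u` and `v` is `Λ(u) = Λ(v) · π_{uv}`.  By the standard probabilistic argument,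
for sufficiently large `C` the optimal solution of the Unique Games problem has value at most `(1 + δ)/q`
with probability close to 1. Indeed, for a fixed assignment of labels, the expected fraction of satisfied
constraints (where the expectation is taken only over random choices of `π_{uv}`) is `1/q`. By the
Central Limit Theorem, the probability that the fraction of satisfied constraints deviates from the
expectation by more than `δ/q` is `o(q^{−n})`. Since the total number of fixed assignments is `qⁿ`, by
the union bound, the Unique Game is at most `(1 + δ)/q` satisfiable with probability approaching to 1."
(with `Δ = ⌈C(q/δ)²⌉`, i.e. `M = Δn/2` constraints.)

This file PROVES that step in counting form (a Chernoff bound in place of the Central Limit Theorem, as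
in the tree's `RandomPairMultigraphCuts.lean` whose Markov inequality is reused), for an ARBITRARY
constraint graph with enough edges:

* `RandomSigns.card_agree_ge_le` — for a fixed target vector `c ∈ A^M` (`|A| = q ≥ 1`), the number of
  `π ∈ A^M` agreeing with `c` in at least `(1+δ)M/q` coordinates is `≤ q^M · e^{−δ²M/(4q)}`
  (`0 ≤ δ ≤ 1`; exponential moment `Σ_π e^{λ·agree} = (q − 1 + e^λ)^M`, `λ = δ/2`);
* `RandomSigns.exists_forall_agree_lt` — union bound: if `|Λ| · e^{−δ²M/(4q)} < 1` then some `π` agrees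
  with EVERY target `c_L`, `L ∈ Λ`, in fewer than `(1+δ)M/q` coordinates;
* `exists_signs_sound` — for pairs `(u_i, v_i)_{i<M}` on `[n]` and labels `{0,1}^t` (`q = 2^t`): if
  `4·q·n·log q < δ²·M` then there are sign patterns `π_i ∈ {0,1}^t` such that EVERY labelling
  `L : [n] → {0,1}^t` satisfies fewer than `(1+δ)M/q` of the constraints `L(v_i) = L(u_i) ⊕ π_i`
  (CMM's (i) for every graph with `M > 4q n log q/δ²` edges, e.g. `Δ`-regular with `Δ > 8 q log q/δ²`).

Consequence (`CharikarMakarychevMakarychev2009_uniqueGamesSA_of_twoLinAllSigns`): the tree's fact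
`CharikarMakarychevMakarychev2009_uniqueGamesSA` follows from the MAX 2LIN(2) Sherali–Adams gap ALONE, in
the form CMM's Theorem 5.3 is claimed to deliver it ("Theorem 5.3 works not only for MAX CUT, but also for
MAX 2LIN", p. 13): for every `Δ₀` and `ε > 0` there are `γ > 0`, `n₀` such that for all `n ≥ n₀` some
constraint graph with `M ≥ Δ₀·n` edges admits, for EVERY sign pattern `σ ∈ {0,1}^M`, a `⌊n^γ⌋`-local
pseudo-density under which each equation `x_{v_i} = x_{u_i} ⊕ σ_i` has pseudo-probability `≥ 1 − ε`.
(The MAX-CUT case `σ ≡ 1` of this hypothesis is the tree's PROVED `CharikarMakarychevMakarychev2009_maxCutSA_holds`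
up to bookkeeping.)  0 named facts; no `sorry`.

## References

* [CharikarMakarychevMakarychev2009] M. Charikar, K. Makarychev, Y. Makarychev, *Integrality gaps for
  Sherali–Adams relaxations*, STOC 2009; Thm 6.1 and its proof sketch (p. 13–14), Thm 5.3 (p. 11).
  Held text `paper:doi-10-1145-1536414-1536455`.
* [AroraBollobasLovaszTourlakis2006] (the first-moment / Chernoff counting style of the tree's
  `RandomPairMultigraphCuts.lean`, whose `RandomPairs.card_filter_mul_le_sum` is reused).
-/

noncomputable section

open Finset

namespace Literature.Combinatorics.Optimization

namespace RandomSigns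

variable {A : Type*} [Fintype A] [DecidableEq A] {M : ℕ}

/-! ### Agreement with a fixed target under a uniformly random `π ∈ A^M` -/

/-- The number of coordinates in which `π` agrees with the target `c` ("the number of satisfied
constraints" for a fixed labelling). [cite: CharikarMakarychevMakarychev2009, Thm 6.1 proof (p. 13: "for a fixed assignment of labels")] -/
def agree (c π : Fin M → A) : ℕ := ((univ : Finset (Fin M)).filter fun i => π i = c i).card

omit [Fintype A] in
/-- `agree` as a sum of indicators. [cite: CharikarMakarychevMakarychev2009, Thm 6.1 proof (p. 13)] -/
theorem agree_eq_sum (c π : Fin M → A) :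
    (agree c π : ℝ) = ∑ i, (if π i = c i then (1 : ℝ) else 0) := by
  rw [agree, Finset.card_filter]
  push_cast
  rfl

/-- **Exponential moment** (independence of the coordinates): `Σ_π e^{λ·agree(c,π)} = (q − 1 + e^λ)^M`.
[cite: CharikarMakarychevMakarychev2009, Thm 6.1 proof (p. 13: "the expected fraction of satisfied constraints … is 1/q")] -/
theorem sum_exp_agree (c : Fin M → A) (t : ℝ) :
    ∑ π : Fin M → A, Real.exp (t * agree c π) = ((Fintype.card A : ℝ) - 1 + Real.exp t) ^ M := by
  classical
  have h1 : ∀ π : Fin M → A, Real.exp (t * agree c π) = ∏ i, (if π i = c i then Real.exp t else 1) := by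
    intro π
    rw [agree_eq_sum, mul_sum, Real.exp_sum]
    refine prod_congr rfl fun i _ => ?_
    split_ifs <;> simp
  simp_rw [h1]
  rw [← Fintype.piFinset_univ, ← Finset.prod_univ_sum (fun _ : Fin M => (univ : Finset A))
    (fun i a => if a = c i then Real.exp t else (1 : ℝ))]
  have h2 : ∀ i : Fin M, ∑ a : A, (if a = c i then Real.exp t else (1 : ℝ)) = (Fintype.card A : ℝ) - 1 + Real.exp t := by
    intro i
    rw [← Finset.sum_erase_add _ _ (mem_univ (c i)), if_pos rfl]
    have : ∑ a ∈ univ.erase (c i), (if a = c i then Real.exp t else (1 : ℝ)) = ((univ.erase (c i)).card : ℝ) := by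
      rw [Finset.sum_congr rfl fun a ha => if_neg (ne_of_mem_erase ha), sum_const, nsmul_eq_mul, mul_one]
    rw [this, card_erase_of_mem (mem_univ _), card_univ, Nat.cast_sub (Fintype.card_pos_iff.mpr ⟨c i⟩),
      Nat.cast_one]
  simp_rw [h2]
  rw [prod_const, card_univ, Fintype.card_fin]

/-- `e^x − 1 ≤ x + x²` for `0 ≤ x ≤ 1`. [folklore] -/
private theorem exp_sub_one_le_sq {x : ℝ} (hx0 : 0 ≤ x) (hx1 : x ≤ 1) : Real.exp x - 1 ≤ x + x ^ 2 := by
  have h := Real.abs_exp_sub_one_sub_id_le (show |x| ≤ 1 by rw [abs_of_nonneg hx0]; exact hx1)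
  have := (abs_le.1 h).2
  linarith

/-- **Chernoff bound, counting form**: for `0 ≤ δ ≤ 1` the number of `π ∈ A^M` agreeing with a fixed
target in at least `(1+δ)M/q` coordinates is at most `q^M e^{−δ²M/(4q)}` (`q = |A|`).
[cite: CharikarMakarychevMakarychev2009, Thm 6.1 proof (p. 13: "the probability that the fraction of satisfied constraints deviates from the expectation by more than δ/q is o(q^{−n})")] -/
theorem card_agree_ge_le [Nonempty A] (c : Fin M → A) {δ : ℝ} (hδ0 : 0 ≤ δ) (hδ1 : δ ≤ 1) :
    ((((univ : Finset (Fin M → A)).filter fun π =>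
        (1 + δ) * M / Fintype.card A ≤ (agree c π : ℝ)).card : ℝ)) ≤
      (Fintype.card A : ℝ) ^ M * Real.exp (-(δ ^ 2 * M / (4 * Fintype.card A))) := by
  classical
  set q : ℝ := (Fintype.card A : ℝ) with hq
  have hq1 : 1 ≤ q := by
    rw [hq]; exact_mod_cast Nat.one_le_iff_ne_zero.mpr Fintype.card_ne_zero
  have hq0 : 0 < q := by linarith
  set lam : ℝ := δ / 2 with hlam
  have hlam0 : 0 ≤ lam := by rw [hlam]; linarith
  have hlam1 : lam ≤ 1 := by rw [hlam]; linarith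
  set a : ℝ := (1 + δ) * M / q with ha
  -- Markov on `e^{λ·agree}` at level `e^{λ a}`
  have hmarkov := RandomPairs.card_filter_mul_le_sum (fun π : Fin M → A => Real.exp (lam * agree c π))
    (fun _ => (Real.exp_pos _).le) (Real.exp (lam * a))
  have hset : ((univ : Finset (Fin M → A)).filter fun π => Real.exp (lam * a) ≤ Real.exp (lam * agree c π)) ⊇
      (univ.filter fun π => a ≤ (agree c π : ℝ)) := by
    intro π hπ
    refine mem_filter.2 ⟨mem_univ _, ?_⟩
    exact Real.exp_le_exp.2 (mul_le_mul_of_nonneg_left (mem_filter.1 hπ).2 hlam0)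
  -- `(q − 1 + e^λ)^M ≤ q^M e^{M(λ+λ²)/q}`
  have hmgf : (q - 1 + Real.exp lam) ^ M ≤ q ^ M * Real.exp (M * ((lam + lam ^ 2) / q)) := by
    have h1 : q - 1 + Real.exp lam ≤ q * Real.exp ((lam + lam ^ 2) / q) := by
      have h2 : q - 1 + Real.exp lam = q * (1 + (Real.exp lam - 1) / q) := by field_simp; ring
      rw [h2]
      refine mul_le_mul_of_nonneg_left ?_ hq0.le
      calc 1 + (Real.exp lam - 1) / q ≤ 1 + (lam + lam ^ 2) / q := by
            gcongr; exact exp_sub_one_le_sq hlam0 hlam1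
        _ ≤ Real.exp ((lam + lam ^ 2) / q) := by
            have := Real.add_one_le_exp ((lam + lam ^ 2) / q); linarith
    have h0 : 0 ≤ q - 1 + Real.exp lam := by have := Real.exp_pos lam; linarith
    calc (q - 1 + Real.exp lam) ^ M ≤ (q * Real.exp ((lam + lam ^ 2) / q)) ^ M := pow_le_pow_left₀ h0 h1 M
      _ = q ^ M * Real.exp (M * ((lam + lam ^ 2) / q)) := by rw [mul_pow, ← Real.exp_nat_mul]
  have hle : (((univ : Finset (Fin M → A)).filter fun π => a ≤ (agree c π : ℝ)).card : ℝ) *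
      Real.exp (lam * a) ≤ q ^ M * Real.exp (M * ((lam + lam ^ 2) / q)) := by
    calc _ ≤ (((univ : Finset (Fin M → A)).filter fun π =>
            Real.exp (lam * a) ≤ Real.exp (lam * agree c π)).card : ℝ) * Real.exp (lam * a) := by
          gcongr
      _ ≤ ∑ π : Fin M → A, Real.exp (lam * agree c π) := hmarkov
      _ = (q - 1 + Real.exp lam) ^ M := by rw [sum_exp_agree, hq]
      _ ≤ _ := hmgf
  -- the exponent: `M(λ+λ²)/q − λ a = −δ²M/(4q)`
  have hexp : q ^ M * Real.exp (M * ((lam + lam ^ 2) / q)) =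
      q ^ M * Real.exp (-(δ ^ 2 * M / (4 * q))) * Real.exp (lam * a) := by
    rw [mul_assoc, ← Real.exp_add]; congr 2; rw [hlam, ha]; field_simp; ring
  rw [hexp] at hle
  exact le_of_mul_le_mul_right hle (Real.exp_pos _)

/-- **Union bound**: if `|Λ| · q^M e^{−δ²M/(4q)} < q^M`, i.e. `|Λ| e^{−δ²M/(4q)} < 1`, then some
`π ∈ A^M` agrees with every target `c_L` (`L ∈ Λ`) in fewer than `(1+δ)M/q` coordinates.
[cite: CharikarMakarychevMakarychev2009, Thm 6.1 proof (p. 13: "Since the total number of fixed assignments is qⁿ, by the union bound")] -/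
theorem exists_forall_agree_lt [Nonempty A] {Λ : Type*} [Fintype Λ] (c : Λ → Fin M → A) {δ : ℝ} (hδ0 : 0 ≤ δ)
    (hδ1 : δ ≤ 1) (hsmall : (Fintype.card Λ : ℝ) * Real.exp (-(δ ^ 2 * M / (4 * Fintype.card A))) < 1) :
    ∃ π : Fin M → A, ∀ L : Λ, (agree (c L) π : ℝ) < (1 + δ) * M / Fintype.card A := by
  classical
  set bad : Finset (Fin M → A) := univ.filter fun π =>
    ∃ L : Λ, (1 + δ) * M / Fintype.card A ≤ (agree (c L) π : ℝ) with hbad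
  have hcard : (bad.card : ℝ) < (Fintype.card (Fin M → A) : ℝ) := by
    have hsub : bad ⊆ (univ : Finset Λ).biUnion fun L =>
        univ.filter fun π => (1 + δ) * M / Fintype.card A ≤ (agree (c L) π : ℝ) := by
      intro π hπ
      obtain ⟨L, hL⟩ := (mem_filter.1 hπ).2
      exact mem_biUnion.2 ⟨L, mem_univ _, mem_filter.2 ⟨mem_univ _, hL⟩⟩
    have hq : (Fintype.card (Fin M → A) : ℝ) = (Fintype.card A : ℝ) ^ M := by
      rw [Fintype.card_fun, Fintype.card_fin]; push_cast; ring
    calc (bad.card : ℝ) ≤ (((univ : Finset Λ).biUnion fun L =>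
          univ.filter fun π => (1 + δ) * M / Fintype.card A ≤ (agree (c L) π : ℝ)).card : ℝ) := by
          exact_mod_cast card_le_card hsub
      _ ≤ ∑ L : Λ, (((univ : Finset (Fin M → A)).filter fun π =>
          (1 + δ) * M / Fintype.card A ≤ (agree (c L) π : ℝ)).card : ℝ) := by
          exact_mod_cast card_biUnion_le
      _ ≤ ∑ _L : Λ, (Fintype.card A : ℝ) ^ M * Real.exp (-(δ ^ 2 * M / (4 * Fintype.card A))) :=
          sum_le_sum fun L _ => card_agree_ge_le (c L) hδ0 hδ1
      _ = ((Fintype.card Λ : ℝ) * Real.exp (-(δ ^ 2 * M / (4 * Fintype.card A)))) * (Fintype.card A : ℝ) ^ M := by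
          rw [sum_const, card_univ, nsmul_eq_mul]; ring
      _ < 1 * (Fintype.card A : ℝ) ^ M := by
          apply mul_lt_mul_of_pos_right hsmall
          have : (0 : ℝ) < Fintype.card A := by exact_mod_cast Fintype.card_pos
          positivity
      _ = (Fintype.card (Fin M → A) : ℝ) := by rw [one_mul, hq]
  have hcard' : bad.card < (univ : Finset (Fin M → A)).card := by
    rw [card_univ]; exact_mod_cast hcard
  obtain ⟨π, -, hπ⟩ := exists_mem_notMem_of_card_lt_card hcard'
  refine ⟨π, fun L => ?_⟩
  by_contra hge
  exact hπ (mem_filter.2 ⟨mem_univ _, L, not_lt.1 hge⟩)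

end RandomSigns

/-! ### Sound sign patterns for a Unique Game on a given constraint graph -/

open UGFromTwoLin

/-- **CMM Thm 6.1 (i), "the standard probabilistic argument", PROVED for every constraint graph with
enough edges:** for pairs `(u_i, v_i)_{i<M}` of variables in `[n]`, labels `{0,1}^t` (`q = 2^t`) and
`0 < δ ≤ 1`, if `4·q·n·log q < δ²·M` then there are sign patterns `π_i ∈ {0,1}^t` such that every
labelling `L : [n] → {0,1}^t` satisfies fewer than `(1+δ)M/q` of the constraints `L(v_i) = L(u_i) ⊕ π_i`.
[cite: CharikarMakarychevMakarychev2009, Thm 6.1 (i) and its proof sketch (p. 13)] -/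
theorem exists_signs_sound {t n M : ℕ} (u v : Fin M → Fin n) {δ : ℝ} (hδ0 : 0 ≤ δ) (hδ1 : δ ≤ 1)
    (hM : 4 * (2 : ℝ) ^ t * n * Real.log ((2 : ℝ) ^ t) < δ ^ 2 * M) :
    ∃ π : Fin M → Fin t → Bool, ∀ L : Fin n → Fin t → Bool,
      (∑ i, if L (v i) = (fun s => xor (L (u i) s) (π i s)) then (1 : ℝ) else 0) <
        (1 + δ) / 2 ^ t * M := by
  classical
  have hq : (Fintype.card (Fin t → Bool) : ℝ) = (2 : ℝ) ^ t := by
    rw [Fintype.card_fun, Fintype.card_bool, Fintype.card_fin]; push_cast; ring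
  have hq0 : (0 : ℝ) < (2 : ℝ) ^ t := by positivity
  -- the targets `c_L(i) = L(v_i) ⊕ L(u_i)`
  set c : (Fin n → Fin t → Bool) → Fin M → Fin t → Bool :=
    fun L i s => xor (L (v i) s) (L (u i) s) with hc
  have hsmall : (Fintype.card (Fin n → Fin t → Bool) : ℝ) *
      Real.exp (-(δ ^ 2 * M / (4 * Fintype.card (Fin t → Bool)))) < 1 := by
    rw [hq]
    have hcardL : (Fintype.card (Fin n → Fin t → Bool) : ℝ) = ((2 : ℝ) ^ t) ^ n := by
      rw [Fintype.card_fun, Fintype.card_fin, Fintype.card_fun, Fintype.card_bool, Fintype.card_fin]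
      push_cast; ring
    rw [hcardL]
    -- `(2^t)^n = Real.exp(n log 2^t)` and `n log(2^t) < δ²M/(4·2^t)`
    have h1 : ((2 : ℝ) ^ t) ^ n = Real.exp (n * Real.log ((2 : ℝ) ^ t)) := by
      rw [← Real.exp_log (pow_pos hq0 n), Real.log_pow]
    rw [h1, ← Real.exp_add]
    rw [Real.exp_lt_one_iff]
    have h2 : (n : ℝ) * Real.log ((2 : ℝ) ^ t) < δ ^ 2 * M / (4 * (2 : ℝ) ^ t) := by
      rw [lt_div_iff₀ (by positivity)]
      nlinarith
    linarith
  obtain ⟨π, hπ⟩ := RandomSigns.exists_forall_agree_lt c hδ0 hδ1 hsmall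
  refine ⟨π, fun L => ?_⟩
  have h := hπ L
  rw [hq, RandomSigns.agree_eq_sum] at h
  have hiff : ∀ i, (π i = c L i) ↔ (L (v i) = fun s => xor (L (u i) s) (π i s)) := by
    intro i
    simp only [hc, funext_iff]
    refine forall_congr' fun s => ?_
    constructor
    · intro h1; rw [h1]; cases L (v i) s <;> cases L (u i) s <;> rfl
    · intro h1; rw [h1]; cases L (u i) s <;> cases π i s <;> rfl
  simp_rw [hiff] at h
  calc (∑ i, if L (v i) = (fun s => xor (L (u i) s) (π i s)) then (1 : ℝ) else 0)
      < (1 + δ) * M / (2 : ℝ) ^ t := h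
    _ = (1 + δ) / 2 ^ t * M := by ring

/-! ### The Unique Games gap from the signed MAX 2LIN(2) gap alone -/

/-- **`CharikarMakarychevMakarychev2009_uniqueGamesSA` from the MAX 2LIN(2) Sherali–Adams gap for all sign
patterns** (CMM: "Theorem 5.3 works not only for MAX CUT, but also for MAX 2LIN", applied to each of the
`t` coordinates; the random signs of Thm 6.1 (i) are supplied by `exists_signs_sound`, the product step by
`UniqueGamesFromTwoLin`).  Hypothesis: for every `t ≥ 1`, `Δ₀` and `ε > 0` there are `γ > 0`, `n₀` such
that for all `n ≥ n₀` some constraint graph on `[n]` with `M ≥ Δ₀ n` pairs `u_i ≠ v_i` admits, for EVERY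
`σ ∈ {0,1}^M`, a `⌊n^γ⌋`-local pseudo-density on `{0,1}ⁿ` (uniform measure) giving each equation
`x_{v_i} = x_{u_i} ⊕ σ_i` pseudo-probability `≥ 1 − ε`.
[cite: CharikarMakarychevMakarychev2009, Thm 6.1 and its proof sketch (p. 13–14), Thm 5.3 (p. 11)] -/
theorem CharikarMakarychevMakarychev2009_uniqueGamesSA_of_twoLinAllSigns
    (h : ∀ t : ℕ, 1 ≤ t → ∀ Δ₀ : ℕ, ∀ ε : ℝ, 0 < ε →
      ∃ γ : ℝ, 0 < γ ∧ ∃ n₀ : ℕ, ∀ n : ℕ, n₀ ≤ n →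
        ∃ (M : ℕ) (_ : 0 < M) (u v : Fin M → Fin n) (_ : ∀ i, u i ≠ v i), Δ₀ * n ≤ M ∧
          ∀ σ : Fin M → Bool, ∃ D : (Fin n → Bool) → ℝ,
            IsLocalPseudoDensity (uniformWeight (Fin n) Bool) ⌊(n : ℝ) ^ γ⌋₊ D ∧
            ∀ i, 1 - ε ≤ muExpect (uniformWeight (Fin n) Bool)
              (fun y => D y * (if y (v i) = xor (y (u i)) (σ i) then (1 : ℝ) else 0))) :
    CharikarMakarychevMakarychev2009_uniqueGamesSA := by
  intro t ht δ hδ hδ1 ε hε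
  -- WLOG `ε ≤ 1 ≤ t`
  set ε' : ℝ := min ε 1 with hε'
  have hε'0 : 0 < ε' := lt_min hε one_pos
  have hε'ε : ε' ≤ ε := min_le_left _ _
  have hε't : ε' ≤ t := le_trans (min_le_right _ _) (by exact_mod_cast ht)
  have ht0 : (0 : ℝ) < t := by exact_mod_cast ht
  -- the edge density making random signs sound
  set q : ℝ := (2 : ℝ) ^ t with hq
  have hq0 : 0 < q := by positivity
  set Δ₀ : ℕ := ⌈4 * q * Real.log q / δ ^ 2⌉₊ + 1 with hΔ₀
  obtain ⟨γ, hγ, n₀, hn₀⟩ := h t ht Δ₀ (ε' / t) (by positivity)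
  refine ⟨γ, hγ, n₀, fun n hn => ?_⟩
  obtain ⟨M, hM, u, v, huv, hMn, hall⟩ := hn₀ n hn
  -- random signs: `4 q n log q < δ² M`
  have hbig : 4 * (2 : ℝ) ^ t * n * Real.log ((2 : ℝ) ^ t) < δ ^ 2 * M := by
    rw [← hq]
    have hMn' : (Δ₀ : ℝ) * n ≤ M := by exact_mod_cast hMn
    have hΔ : 4 * q * Real.log q / δ ^ 2 < Δ₀ := by
      rw [hΔ₀]; push_cast
      linarith [Nat.le_ceil (4 * q * Real.log q / δ ^ 2)]
    have hlogq : 0 ≤ Real.log q := Real.log_nonneg (by rw [hq]; exact one_le_pow₀ (by norm_num))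
    rcases Nat.eq_zero_or_pos n with hn0 | hnpos
    · subst hn0
      have : (0 : ℝ) < M := by exact_mod_cast hM
      simp only [Nat.cast_zero, mul_zero, zero_mul]
      positivity
    · have hn' : (0 : ℝ) < n := by exact_mod_cast hnpos
      have h1 : 4 * q * Real.log q < δ ^ 2 * Δ₀ := by
        rw [div_lt_iff₀ (by positivity)] at hΔ; linarith
      calc 4 * q * n * Real.log q = (4 * q * Real.log q) * n := by ring
        _ < (δ ^ 2 * Δ₀) * n := mul_lt_mul_of_pos_right h1 hn'
        _ = δ ^ 2 * ((Δ₀ : ℝ) * n) := by ring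
        _ ≤ δ ^ 2 * M := mul_le_mul_of_nonneg_left hMn' (sq_nonneg _)
  obtain ⟨π, hπ⟩ := exists_signs_sound u v hδ.le hδ1.le hbig
  -- the `t` MAX 2LIN(2) pseudo-densities
  have hSA : ∀ s : Fin t, ∃ D : (Fin n → Bool) → ℝ,
      IsLocalPseudoDensity (uniformWeight (Fin n) Bool) ⌊(n : ℝ) ^ γ⌋₊ D ∧
      ∀ i, 1 - ε' / t ≤ muExpect (uniformWeight (Fin n) Bool)
        (fun y => D y * (if y (v i) = xor (y (u i)) (π i s) then (1 : ℝ) else 0)) :=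
    fun s => hall (fun i => π i s)
  choose D hD hval using hSA
  refine ⟨ugOfXor hM u v huv π, ugOfXor_optLE hM u v huv π (fun L => (hπ L).le), prodDensity D,
    isLocalPseudoDensity_prodDensity hD, ?_⟩
  have hmain := muExpect_prodDensity_val hM u v huv π (D := D) hε'0.le hε't (fun s i => hval s i)
  linarith

end Literature.Combinatorics.Optimization
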